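/-
Copyright (c) 2026 the pub-hodgecm-mathlib formalisation cell (harness21).  Prover seat hodgecm-mathlib-K2E5-p17 (g7), Track B «K2-LIT»,
#184♮ = hLiu418 = `stmt-HodgeConjecture-24832`; (σ) endgame organ, letter (m1)-SPLIT «unimodularity of `U(V′_v)` at a split place» (K2E5-plan (g7) 13:32:33Z,
LEAD F0P6-plan (g14) σ18 (q8)).  FILE 1 of 2: `GLₙ(F)` is unimodular (generic `n`) — the `n`-general twin of ★ (GL-U) `K2E3GL3ModCentreUnimodular` without the quotient.
-/
import Summits.HodgeConjecture.HodgeConjecture.Theorems.K2E3GL3ModCentreUnimodular   -- ★ (GL-U) (K2E3-p23): generic `modularCharacter_mulEquiv_eq`; brings ★ Cartan `GLₙ`, `glInt`, `glTranspose`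
import Literature.MeasureTheory.Group.HaarRightInvariantCompactSubgroup               -- ★ `modularCharacter_eq_one_of_mem_isCompact`, `map_mul_right_eq_modularCharacter_smul`
import Literature.NumberTheory.Automorphic.GLnGelfandKazhdanInvolution                -- ★ `locallyCompactSpace_generalLinearGroup`
import Literature.NumberTheory.Weil1964.GLnRestrictedProductHaar                      -- ★ `secondCountableTopology_generalLinearGroup`
import HarnessLib

/-!
# Crux `HLiu418`, (σ) organ, letter (m1)-SPLIT, FILE 1: `GLₙ(F)` IS UNIMODULAR over a non-archimedean local field — every Haar measure on `GL (Fin n) F` is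
# right invariant (transpose-inverse involution + Cartan decomposition + `Δ = 1` on the compact open `GLₙ(𝒪)`)

Cell `hodgecm-mathlib`, crux item hLiu418 = `stmt-HodgeConjecture-24832`, route of record `HCCMUnconditional`; squad K2 ∕ K2Liu, prover K2E5-p17 (g7).
THEOREMS ONLY (no `def`, no instance, no notation, no named-fact hypothesis, no `sorry`); lane `--supports stmt-HodgeConjecture-24832 --as helper` (count-neutral).

WHY.  The (σ) endgame (V8-inst, K2Liu-p09 (g6)) carries the unimodularity of the local unitary group `U(V′_v)` as a BY-VALUE binder `[μG.IsMulRightInvariant]`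
(★ V8d `exists_average`); at a SPLIT place `v` of `L∕L⁺`, `U(V′_v) ≅ GL₃(L⁺_v)` (the tree's split reading), so the binder is «`GL₃` of a local field is
unimodular».  The tree proves `GL₃(F)⧸Z` and `GL₃(F)⧸Λ·1` unimodular (★ `K2E3GL3ModCentreUnimodular`, ★ `K2E3GL3ModCocompactUnimodular`, K2E3-p23) and
`GL₂(F)⧸Z` (★ `K2E3GL2ModCentreUnimodular`); this file runs the SAME argument on `GLₙ(F)` itself, for every `n`:
the transpose-inverse automorphism `θ(g) = (gᵀ)⁻¹` is a bi-continuous involution with `θ(t) = t⁻¹` on the diagonal torus `t = zpowDiagGL a`, so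
`Δ(t)⁻¹ = Δ(θ t) = Δ(t)` (★ generic `modularCharacter_mulEquiv_eq`) and `Δ(t) = 1`; `Δ = 1` on the compact open `GLₙ(𝒪)` (★ `isCompact_glInt`,
★ `modularCharacter_eq_one_of_mem_isCompact`); and `GLₙ(F) = GLₙ(𝒪) · T · GLₙ(𝒪)` (★ Cartan `exists_glInt_mul_mul_eq_zpowDiagGL`).  Hence `Δ ≡ 1` and
`(· g)_* μ = Δ(g) • μ = μ` (★ `map_mul_right_eq_modularCharacter_smul`).
* §1 `transposeInv_transposeInv`, `coe_transposeInv`, `continuous_transposeInv`, `transposeInv_zpowDiagGL` (any `n`; the `n = 2` versions are ★ `K2E3GL2ModCentreUnimodular.*`);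
* §2 `modularCharacter_zpowDiagGL_eq_one`, **`modularCharacter_gl_eq_one`**, **`isMulRightInvariant_gl_of_isHaarMeasure`** (second countability ∕ local compactness of
  `GLₙ(F)` are ★ `Weil1964.secondCountableTopology_generalLinearGroup` ∕ ★ `locallyCompactSpace_generalLinearGroup`).
FILE 2 (`K2LiuLocalUnitaryUnimodularSplit`, after the carrier letters of p09's I-2) transports this along the split reading `U(J′)(L_v) ≃ₜ* GL₃(L⁺_v)`.
HONEST LABEL: HC_CM is proved only modulo the 7 printed citations (2 remaining named inputs: hLiu418 = stmt-HodgeConjecture-24832, h413 = stmt-HodgeConjecture-24833) until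
rung 0 closes; local structure theory, count-neutral helper, closes no item.
Search: Mathlib has `modularCharacter`, `Measure.IsHaarMeasure`, `MulEquiv.isHaarMeasure_map` but no group-specific unimodularity; tree as above; dedup
`rg "modularCharacter_gl_eq_one|isMulRightInvariant_gl_of_isHaarMeasure"` — none.
References: [Cartier1979] P. Cartier, *Representations of p-adic groups: a survey*, PSPM 33.1 (1979), §I.3 (reductive `p`-adic groups are unimodular), §IV.1;
[Folland1995] G. B. Folland, *A Course in Abstract Harmonic Analysis* (1995), §2.4, Prop. 2.27; [BruhatTits1972] Publ. Math. IHÉS 41, (4.4.3) (Cartan decomposition).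
-/

set_option autoImplicit false
-- the mandated namespace repeats `HodgeConjecture.HodgeConjecture`
set_option linter.dupNamespace false

noncomputable section

open MeasureTheory MeasureTheory.Measure Set ValuativeRel Matrix
open scoped ENNReal NNReal MatrixGroups Pointwise WithZero Valued Topology

namespace Summit.HodgeConjecture.HodgeConjecture.Cruxes.HLiu418.K2LiuGLnUnimodular

open Literature.NumberTheory.Automorphic Literature.MeasureTheory.Group
open Literature.NumberTheory.GaloisRepresentations Literature.NumberTheory.GaloisRepresentations.IsNonarchimedeanLocalField
open Summit.HodgeConjecture.HodgeConjecture.Cruxes.H413.K2E3GL3ModCentreUnimodular (modularCharacter_mulEquiv_eq)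

/-! ## §1 The transpose-inverse automorphism of `GLₙ(F)` -/

section TransposeInv

variable {F : Type*} [Field F] (n : ℕ)

/-- `θ(g) = (gᵀ)⁻¹` is an involution of `GLₙ(F)`: `θ (θ g) = g`. [folklore] -/
theorem transposeInv_transposeInv (g : GL (Fin n) F) :
    ((glTranspose (Fin n)).trans (MulEquiv.inv' (GL (Fin n) F)).symm) (((glTranspose (Fin n)).trans (MulEquiv.inv' (GL (Fin n) F)).symm) g) = g := by
  apply Units.ext
  simp [MulEquiv.trans_apply, glTranspose]

/-- The matrix of `θ(g)` is `(g⁻¹)ᵀ` and the matrix of `θ(g)⁻¹` is `gᵀ`. [folklore] -/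
theorem coe_transposeInv (g : GL (Fin n) F) :
    ((((glTranspose (Fin n)).trans (MulEquiv.inv' (GL (Fin n) F)).symm) g : GL (Fin n) F) : Matrix (Fin n) (Fin n) F) =
        (((g⁻¹ : GL (Fin n) F)) : Matrix (Fin n) (Fin n) F)ᵀ ∧
      (((((glTranspose (Fin n)).trans (MulEquiv.inv' (GL (Fin n) F)).symm) g)⁻¹ : GL (Fin n) F) : Matrix (Fin n) (Fin n) F) =
        ((g : GL (Fin n) F) : Matrix (Fin n) (Fin n) F)ᵀ := by
  constructor
  · simp [MulEquiv.trans_apply, glTranspose, Matrix.transpose_nonsing_inv]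
  · simp [MulEquiv.trans_apply, glTranspose]

/-- `θ` is continuous. [folklore] -/
theorem continuous_transposeInv [TopologicalSpace F] [IsTopologicalRing F] :
    Continuous ((glTranspose (Fin n)).trans (MulEquiv.inv' (GL (Fin n) F)).symm : GL (Fin n) F → GL (Fin n) F) := by
  refine Units.continuous_iff.2 ⟨?_, ?_⟩
  · have h : (Units.val ∘ ((glTranspose (Fin n)).trans (MulEquiv.inv' (GL (Fin n) F)).symm : GL (Fin n) F → GL (Fin n) F)) =
        fun g : GL (Fin n) F => (((g⁻¹ : GL (Fin n) F)) : Matrix (Fin n) (Fin n) F)ᵀ := funext fun g => (coe_transposeInv n g).1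
    rw [h]
    exact Units.continuous_coe_inv.matrix_transpose
  · have h : (fun g : GL (Fin n) F => (((((glTranspose (Fin n)).trans (MulEquiv.inv' (GL (Fin n) F)).symm) g)⁻¹ : GL (Fin n) F) : Matrix (Fin n) (Fin n) F)) =
        fun g : GL (Fin n) F => ((g : GL (Fin n) F) : Matrix (Fin n) (Fin n) F)ᵀ := funext fun g => (coe_transposeInv n g).2
    rw [h]
    exact Units.continuous_val.matrix_transpose

/-- `θ(zpowDiagGL a) = (zpowDiagGL a)⁻¹` (diagonal matrices are symmetric). [folklore] -/
theorem transposeInv_zpowDiagGL {ϖ : F} (hϖ0 : ϖ ≠ 0) (a : Fin n → ℤ) :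
    ((glTranspose (Fin n)).trans (MulEquiv.inv' (GL (Fin n) F)).symm) (zpowDiagGL (n := n) hϖ0 a) = (zpowDiagGL (n := n) hϖ0 a)⁻¹ := by
  have ht : (glTranspose (Fin n) (zpowDiagGL (n := n) hϖ0 a)).unop = zpowDiagGL (n := n) hϖ0 a := by
    apply Units.ext
    rw [coe_unop_glTranspose, coe_zpowDiagGL, Matrix.diagonal_transpose]
  simp [MulEquiv.trans_apply, ht]

end TransposeInv

/-! ## §2 `Δ ≡ 1` on `GLₙ(F)` and right invariance of every Haar measure -/

section Unimodular

variable {F : Type*} [Field F] [Valued F ℤᵐ⁰] [ValuativeRel F] [(Valued.v : Valuation F ℤᵐ⁰).Compatible] [IsNonarchimedeanLocalField F] (n : ℕ)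
  [MeasurableSpace (GL (Fin n) F)] [BorelSpace (GL (Fin n) F)]

omit [(Valued.v : Valuation F ℤᵐ⁰).Compatible] in
/-- **`Δ(t) = 1` on the torus**: `θ(t) = t⁻¹` for the bi-continuous involution `θ`, so `Δ(t)⁻¹ = Δ(θ t) = Δ(t)` (★ `modularCharacter_mulEquiv_eq`) and
`Δ(t) = 1` in `ℝ≥0`. [cite: Folland1995, §2.4] [cite: Cartier1979, §I.3] -/
theorem modularCharacter_zpowDiagGL_eq_one [LocallyCompactSpace (GL (Fin n) F)] {ϖ : F} (hϖ0 : ϖ ≠ 0)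
    (a : Fin n → ℤ) : modularCharacter (zpowDiagGL (n := n) hϖ0 a) = 1 := by
  haveI : SecondCountableTopology (GL (Fin n) F) := Literature.NumberTheory.Weil1964.secondCountableTopology_generalLinearGroup F n
  set θ : GL (Fin n) F ≃* GL (Fin n) F := (glTranspose (Fin n)).trans (MulEquiv.inv' (GL (Fin n) F)).symm with hθ
  have hθc : Continuous θ := continuous_transposeInv n
  have hinv : ∀ x, θ (θ x) = x := fun x => by rw [hθ, transposeInv_transposeInv]
  have hsymm : ∀ x, θ.symm x = θ x := fun x => by
    conv_lhs => rw [← hinv x]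
    exact θ.symm_apply_apply _
  have hθsc : Continuous θ.symm := by
    have : (θ.symm : _ → _) = θ := funext hsymm
    rw [this]; exact hθc
  have hΔ := modularCharacter_mulEquiv_eq θ hθc hθsc (zpowDiagGL (n := n) hϖ0 a)
  rw [hθ, transposeInv_zpowDiagGL n hϖ0, map_inv] at hΔ
  set x : ℝ≥0 := modularCharacter (zpowDiagGL (n := n) hϖ0 a) with hx
  have hxpos : (0 : ℝ) < (x : ℝ) := by exact_mod_cast modularCharacterFun_pos (G := GL (Fin n) F) _
  have hxinv : ((x : ℝ))⁻¹ = (x : ℝ) := by rw [← NNReal.coe_inv, hΔ]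
  have hxx : (x : ℝ) * (x : ℝ) = 1 := by
    calc (x : ℝ) * (x : ℝ) = ((x : ℝ))⁻¹ * (x : ℝ) := by rw [hxinv]
      _ = 1 := inv_mul_cancel₀ hxpos.ne'
  have hreal : (x : ℝ) = 1 := by
    rcases mul_self_eq_one_iff.1 hxx with h | h
    · exact h
    · linarith
  exact_mod_cast hreal

/-- **THE MODULAR CHARACTER OF `GLₙ(F)` IS TRIVIAL**: `Δ = 1` on the compact open `GLₙ(𝒪)` (★ `isCompact_glInt`, ★ `modularCharacter_eq_one_of_mem_isCompact`) and on
the torus (`modularCharacter_zpowDiagGL_eq_one`), and `g = k₁⁻¹ t k₂⁻¹` by the Cartan decomposition ★ `exists_glInt_mul_mul_eq_zpowDiagGL`.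
[cite: Cartier1979, §I.3] [cite: BruhatTits1972, (4.4.3)] -/
theorem modularCharacter_gl_eq_one [LocallyCompactSpace (GL (Fin n) F)] {ϖ : F} (hϖ : Valued.v ϖ = WithZero.exp (-1 : ℤ)) (g : GL (Fin n) F) :
    modularCharacter g = 1 := by
  haveI : SecondCountableTopology (GL (Fin n) F) := Literature.NumberTheory.Weil1964.secondCountableTopology_generalLinearGroup F n
  haveI := isDiscreteValuationRing_integer_of_compatible hϖ
  have hu : IsUniformizingElement ϖ := isUniformizingElement_of_v_eq hϖ
  have hKc : IsCompact ((glInt n F : Subgroup (GL (Fin n) F)) : Set (GL (Fin n) F)) := isCompact_glInt n F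
  obtain ⟨k₁, hk₁, k₂, hk₂, a, -, heq⟩ := exists_glInt_mul_mul_eq_zpowDiagGL hu g
  have hg : g = k₁⁻¹ * zpowDiagGL hu.ne_zero a * k₂⁻¹ := by rw [← heq]; group
  rw [hg, map_mul, map_mul, modularCharacter_eq_one_of_mem_isCompact _ hKc (inv_mem hk₁), modularCharacter_eq_one_of_mem_isCompact _ hKc (inv_mem hk₂),
    modularCharacter_zpowDiagGL_eq_one n hu.ne_zero a, one_mul, one_mul]

/-- **`GLₙ(F)` IS UNIMODULAR**: every Haar measure on `GL (Fin n) F` is right invariant (`(· g)_* μ = Δ(g) • μ = μ`). [cite: Cartier1979, §I.3] [cite: Folland1995, §2.4] -/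
theorem isMulRightInvariant_gl_of_isHaarMeasure {ϖ : F} (hϖ : Valued.v ϖ = WithZero.exp (-1 : ℤ)) (μ : Measure (GL (Fin n) F)) [μ.IsHaarMeasure] :
    μ.IsMulRightInvariant := by
  haveI : SecondCountableTopology (GL (Fin n) F) := Literature.NumberTheory.Weil1964.secondCountableTopology_generalLinearGroup F n
  haveI : LocallyCompactSpace (GL (Fin n) F) := locallyCompactSpace_generalLinearGroup F (n := n)
  refine ⟨fun g => ?_⟩
  rw [map_mul_right_eq_modularCharacter_smul μ g, modularCharacter_gl_eq_one n hϖ g, one_smul]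

end Unimodular

end Summit.HodgeConjecture.HodgeConjecture.Cruxes.HLiu418.K2LiuGLnUnimodular

end
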